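import Literature.AlgebraicGeometry.AbelianSchemes.RigidifiedGluing
import Literature.AlgebraicGeometry.AbelianSchemes.AbelianSchemeSteinOfNoetherian
import HarnessLib

/-!
# Universal property of a Poincaré-type family: from AFFINE test schemes to ALL test schemes, over a locally Noetherian base

Layer `Literature/AlgebraicGeometry/AbelianSchemes`, namespace `Literature.AlgebraicGeometry.AbelianSchemes.AbelianSchemeOver`.
THEOREMS ONLY (no definition, no named fact, no instance, no notation, no `sorry`; net Literature debt 0).

[MumfordAV1970] §13, proof of the Theorem p. 125 (the reduction of the universal property to convenient test schemes) and
[MilneAV2008] I §8 (Thm. 8.9, uniqueness + gluing): for abelian schemes `A`, `B` over `S`, a rank-one `𝒫` on `A ×_S B` rigidified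
along `ε_A × 1_B`, the `∃!` of classifying maps `T → B` for rigidified fibrewise-`Pic⁰` line bundles on `A_T` is ZARISKI-LOCAL on
the test scheme `T` — granted the rigidified gluing property (★ `PoincareUniversalLocality.existsUnique_classify_of_affine`), which
holds as soon as `A_T → T` is Stein for every `T` (★ `RigidifiedGluing.rigidifiedGluing_of_stein`).  Over a LOCALLY NOETHERIAN base
`S`, `A_T → T` IS Stein for EVERY `T` (★ `AbelianSchemeSteinOfNoetherian.baseChange_app_bijective`, [GortzWedhorn2023] Cor. 24.63),
so no hypothesis remains:

* `rigidifiedGluing_of_isLocallyNoetherian` — `A.RigidifiedGluing B 𝒫` for every rank-one `𝒫`, `S` locally Noetherian;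
* **`existsUnique_classify_of_affine_of_isLocallyNoetherian`** — `∃!` over all affine `T` ⇒ `∃!` over all `T`.

This is the hypothesis-free half (0b)+(0c) of node N0 «affine finite type ⇒ all» of the ℂ-engine port (★
`Motives/PoincareUniversal/AffineFiniteTypeToAll` composes the same two bricks with the `A₀ × Spec K` Stein instance); the
remaining half (0d) «affine finite type ⇒ affine» is the Noetherian-approximation descent (★ `RigidifiedLineBundleLimitDescent`,
field-lettered).  Cell `hodgecm-mathlib` (D-0151), FLOOR 0 P1, F-3 (M) grandchild line `F3DualAbelianSchemeMc` (lead B-p02 (g16)),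
stub `stub_McN0`.  Count-neutral; HC_CM is proved only modulo the 7 printed citations until rung 0 closes; nothing here is about HC.

Mathlib searched (pin): nothing beyond the ★ files; Mathlib has no abelian schemes.

## References
* [MumfordAV1970] D. Mumford, *Abelian Varieties* (1970), §13 (Thm. p. 125 and its proof).
* [MilneAV2008] J. S. Milne, *Abelian Varieties* (v2.00, 2008), I §8 pp. 36–37 (Thm. 8.9).
* [GortzWedhorn2023] U. Görtz, T. Wedhorn, *Algebraic Geometry II* (2023), Cor. 24.63 (p. 404).
-/

set_option autoImplicit false

noncomputable section

universe u

open CategoryTheory CategoryTheory.Limits AlgebraicGeometry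
open Literature.AlgebraicGeometry.Modules Literature.AlgebraicGeometry.Motives Literature.AlgebraicGeometry.AbelianVarieties

namespace Literature.AlgebraicGeometry.AbelianSchemes

namespace AbelianSchemeOver

variable {S : Scheme.{u}} [IsLocallyNoetherian S] (A B : AbelianSchemeOver S) (P : (A.prodLeft B).Modules)

/-- **Rigidified gluing holds for every abelian scheme over a locally Noetherian base**: `A_T → T` is Stein for every test
scheme `T` (★ `baseChange_app_bijective`), so ★ `rigidifiedGluing_of_stein` applies to any rank-one `𝒫` on `A ×_S B`.
[cite: GortzWedhorn2023, Cor. 24.63 (p. 404)] [cite: MumfordAV1970, §13 (proof of the Thm. p. 125)] -/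
theorem rigidifiedGluing_of_isLocallyNoetherian (hP1 : HasRank P 1) : A.RigidifiedGluing B P :=
  A.rigidifiedGluing_of_stein B P hP1 fun f W => A.baseChange_app_bijective f W

/-- **`∃!` of classifying maps over ALL test schemes from `∃!` over the AFFINE ones**, for a rank-one `𝒫` on `A ×_S B`
rigidified along `ε_A × 1_B`, `S` locally Noetherian: ★ `existsUnique_classify_of_affine` with the gluing hypothesis discharged
by `rigidifiedGluing_of_isLocallyNoetherian`. [cite: MumfordAV1970, §13 (proof of the Thm. p. 125)] [cite: MilneAV2008, I §8 (Thm. 8.9, pp. 36–37)] -/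
theorem existsUnique_classify_of_affine_of_isLocallyNoetherian (hP1 : HasRank P 1)
    (hP : Nonempty ((Scheme.Modules.pullback (A.unitSlice B)).obj P ≅ SheafOfModules.unit _))
    (haff : ∀ (T' : Scheme.{u}) [IsAffine T'] (f' : T' ⟶ S) (ℒ' : A.RigidifiedLineBundle f'), ℒ'.FibrewisePicZero →
      ∃! g : {g : T' ⟶ B.X.left // g ≫ B.X.hom = f'},
        Nonempty ((Scheme.Modules.pullback (A.baseChangeToProd B f' g.1 g.2)).obj P ≅ ℒ'.L))
    {T : Scheme.{u}} (f : T ⟶ S) (ℒ : A.RigidifiedLineBundle f) (hℒ : ℒ.FibrewisePicZero) :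
    ∃! g : {g : T ⟶ B.X.left // g ≫ B.X.hom = f},
      Nonempty ((Scheme.Modules.pullback (A.baseChangeToProd B f g.1 g.2)).obj P ≅ ℒ.L) :=
  A.existsUnique_classify_of_affine B P (A.rigidifiedGluing_of_isLocallyNoetherian B P hP1) hP haff f ℒ hℒ

end AbelianSchemeOver

end Literature.AlgebraicGeometry.AbelianSchemes

end
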